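import Mathlib
import HarnessLib
import Summits.Parity.GeneralizedHardyLittlewood.Theses.LiouvilleMAD
import Summits.Parity.GeneralizedHardyLittlewood.Theorems.DilatedChowla.Negative.DilatedChowlaMirrorDefs
import Summits.Parity.GeneralizedHardyLittlewood.Theorems.DilatedChowla.Negative.DilatedChowlaMirrorOnePointDefs
import Summits.Parity.GeneralizedHardyLittlewood.Theorems.DilatedChowla.Negative.DilatedChowlaGram
import Summits.Parity.GeneralizedHardyLittlewood.Theorems.DilatedChowla.Negative.DilatedChowlaWelch
import Summits.Parity.GeneralizedHardyLittlewood.Theorems.DilatedChowla.Negative.DilatedChowlaDispersion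
import Summits.Parity.GeneralizedHardyLittlewood.Theorems.DilatedChowla.Negative.DilatedChowlaMirrorMoebiusExc
import Summits.Parity.GeneralizedHardyLittlewood.Theorems.DilatedChowla.Negative.DilatedChowlaMirrorMoebiusNonexc
import Summits.Parity.GeneralizedHardyLittlewood.Theorems.DilatedChowla.Negative.DilatedChowlaMirrorTransfer
import Summits.Parity.GeneralizedHardyLittlewood.Theorems.DilatedChowla.Negative.DilatedChowlaMirrorOrthogonality
import Summits.Parity.GeneralizedHardyLittlewood.Theorems.DilatedChowla.Negative.DilatedChowlaMirrorBias2

/-!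
# Skeleton — line `Sketch` (card `siegel-mirror`) for crux `DilatedChowla` (stmt-Parity-13319), rev 3 (ALL STUBS CLOSED)

Route `LiouvilleMAD` (rank-4 crux, node), decl
`Summit.Parity.GeneralizedHardyLittlewood.Theses.LiouvilleMAD.DilatedChowla`:
for every `c ≠ 0` there are `κ > 0` and `C` with
`|Σ_{m ∈ (M,2M]} λ(mn+c) λ(mn'+c)| ≤ C · M^{1−κ}` for all `M` and all `1 ≤ n ≠ n' ≤ 2M`.

## Honest status of this line (lead, 2026-08-16)

The crux is an OPEN PROBLEM (power-saving two-point Chowla, uniform in dilations; 2-point Chowla is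
open even under GRH — Tao–Teräväinen 2021 §1.1).  Neither checked evidence file seated as a "line"
contains a composition `DilatedChowla_of`; none can (so `ledger skeleton check` reports
`skeleton.missing`, by design).  The line is driven as a MIRROR line: its composition `siegelMirror`
concludes, from the crux BY NAME, a zero-free statement for real zeros of quadratic Dirichlet
`L`-functions — `DilatedChowla → ∃ C₀ > 0, ¬ SiegelZerosAbove (C₀ · log)`, i.e. no Siegel zero of
quality `η ≥ C₀ log q` at large conductors, i.e. `L(σ,χ) ≠ 0` on `[1 − 1/(C₀ log² q), 1)` — known
unconditionally only with Siegel's ineffective `q^{−ε}`.  Route KILL CRITERION (ii) ("does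
DilatedChowla ⇒ a zero-free region?") is thereby answered YES for real zeros, kernel-checked.

## Stubs — rev 3 (ALL STUBS CLOSED) (vocabulary and interfaces LANDED: `DilatedChowlaMirrorDefs` p96306,
## `DilatedChowlaMirrorOnePointDefs` p97619)

CLOSED (landed, imported):
* `not_dilatedChowla_of_coherentBias` (Gram lever, p96746), `exists_abs_S_ge_sqrt` +
  `not_dilatedChowlaAbove_half` (Welch floor: κ ≤ 1/2, p96972), `powerDispersion_of_dilatedChowla`
  (dispersion consequence, p97340).
CLOSED in wave 2 (the analytic stub `SiegelZerosAbove (C₀·log) → CoherentBias 1`, reshaped into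
five pieces along the landed interfaces; A p98803+p100732, B p99606, C p100427, D p99484, E …Bias/…Bias2):
* `stub_moebiusExc`   : `∃ c₁ C₁ C₂ > 0, MoebiusExcLaw c₁ C₁ C₂` — the twisted Möbius sum of the
  exceptional real character, `M(x,ψ) = x^β/(β L'(β,ψ)) + O(x/k⁶)` (MV §11.3 Ex. 7–8 + Thm 11.16; the
  tree's `MoebiusTwist.exists_excPsiData_twist`, exceptional branch made explicit).
* `stub_moebiusNonexc`: `∃ c₁ C₁ > 0, MoebiusNonexcLaw c₁ C₁` — every other character mod `k`:
  `‖M(x,Ξ)‖ ≤ x/k⁶` (tree `exists_excPsiData_all` + Landau same-level repulsion).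
* `stub_transfer`     : `MoebiusLaws → CharTwist` (`λ = 𝟙_□ ∗ μ`, tree `sum_liouville_twist_eq`).
* `stub_orthogonality`: `CharTwistLaw c₁ C₁ C₂ → OnePointExcLaw c₁ C₁ C₂` (characters mod `k`).
* `stub_bias`         : `OnePointExc → ∃ C₀ > 0, SiegelZerosAbove (C₀·log) → CoherentBias 1`
  (parameters `V = q`, `M = ⌈exp(C₁(1 + 2 log q)²)⌉`, `b = 1/(4C₂(1 + 2 log q)⁵)`, undamped since
  `log(2kM) ≤ η log q`).

## Disproof used

No `Disproof.lean` published to `Cruxes/DilatedChowla/` (checked 2026-08-16T10:2xZ, re-checked each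
turn); `disproof_path` (cdisprove seat folder) is not mounted in this jail.
-/

noncomputable section

namespace Summit.Parity.GeneralizedHardyLittlewood.Cruxes.DilatedChowla.SiegelMirror

open Summit.Parity.GeneralizedHardyLittlewood.Theses.LiouvilleMAD
open Summit.Parity.GeneralizedHardyLittlewood.Theorems.DilatedChowla.Negative
open Finset

/-! ### §1 Closed stubs (landed) -/

/-- CLOSED (p96746): a coherent class bias refutes the crux (Gram positivity in the dilation
variable + Cauchy–Schwarz). -/
theorem stub_gram {c : ℤ} (hc : c ≠ 0) (h : CoherentBias c) : ¬ DilatedChowla :=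
  not_dilatedChowla_of_coherentBias hc h

/-- CLOSED (p96972): the Welch / rank floor. -/
theorem stub_welch (c : ℤ) (M : ℕ) (hM : (|c| : ℝ) < M) :
    ∃ n n' : ℕ, 1 ≤ n ∧ 1 ≤ n' ∧ n ≠ n' ∧ n ≤ 2 * M ∧ n' ≤ 2 * M ∧
      Real.sqrt ((M : ℝ) / 2) ≤ |S c n n' M| :=
  exists_abs_S_ge_sqrt c M hM

/-- CLOSED (p96972): the `κ > 1/2` strengthening of the crux is false. -/
theorem stub_noExponentAboveHalf : ¬ DilatedChowlaAbove (1 / 2) :=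
  not_dilatedChowlaAbove_half

/-- CLOSED (p97340): the crux implies power dispersion. -/
theorem stub_dispersion (h : DilatedChowla) : PowerDispersion :=
  powerDispersion_of_dilatedChowla h

/-! ### §2 The analytic chain (interfaces in `DilatedChowlaMirrorOnePointDefs`) — all closed -/

/-- CLOSED (A, p100732). The exceptional-character Möbius law. -/
theorem stub_moebiusExc : ∃ c₁ C₁ C₂ : ℝ, 0 < c₁ ∧ 0 < C₁ ∧ 0 < C₂ ∧ MoebiusExcLaw c₁ C₁ C₂ :=
  moebiusExcLaw

/-- CLOSED (B, p99606). The non-exceptional-character Möbius law. -/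
theorem stub_moebiusNonexc : ∃ c₁ C₁ : ℝ, 0 < c₁ ∧ 0 < C₁ ∧ MoebiusNonexcLaw c₁ C₁ :=
  moebiusNonexcLaw

/-- CLOSED (C, p100427). Transfer `μ → λ` (`λ = 𝟙_□ ∗ μ`). -/
theorem stub_transfer (h : MoebiusLaws) : CharTwist :=
  charTwist_of_moebiusLaws h

/-- CLOSED (D, p99484). Orthogonality: per-character law ⇒ unit-class law. -/
theorem stub_orthogonality {c₁ C₁ C₂ : ℝ} (h : CharTwistLaw c₁ C₁ C₂) : OnePointExcLaw c₁ C₁ C₂ :=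
  onePointExcLaw_of_charTwistLaw h

/-- CLOSED (E). Parameter bookkeeping: the unit-class law turns Siegel zeros of quality
`≥ C₀ log q` into a coherent class bias at shift `1`. -/
theorem stub_bias (h : OnePointExc) :
    ∃ C₀ : ℝ, 0 < C₀ ∧ (SiegelZerosAbove (fun q => C₀ * Real.log q) → CoherentBias 1) :=
  coherentBias_one_of_onePointExc h

/-! ### §3 Composition (no `sorry` of its own) -/

/-- The two Möbius laws at common constants. -/
theorem moebiusLaws : MoebiusLaws := by
  obtain ⟨c₁, C₁, C₂, hc₁, hC₁, hC₂, hA⟩ := stub_moebiusExc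
  obtain ⟨c₁', C₁', hc₁', hC₁', hB⟩ := stub_moebiusNonexc
  refine ⟨min c₁ c₁', max C₁ C₁', C₂, lt_min hc₁ hc₁', lt_max_of_lt_left hC₁, hC₂, ?_, ?_⟩
  · exact hA.mono (min_le_left _ _) (le_max_left _ _)
  · exact hB.mono (min_le_right _ _) (le_max_right _ _)

/-- The unit-class law. -/
theorem onePointExc : OnePointExc :=
  onePointExc_of_charTwist (fun _ _ _ _ _ _ h => stub_orthogonality h) (stub_transfer moebiusLaws)

/-- **The Siegel mirror**: the crux implies that Siegel zeros of quality `≥ C₀ log q` do not occur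
at large conductors. -/
theorem siegelMirror (h : DilatedChowla) :
    ∃ C₀ : ℝ, 0 < C₀ ∧ ¬ SiegelZerosAbove (fun q => C₀ * Real.log q) := by
  obtain ⟨C₀, hC₀, himp⟩ := stub_bias onePointExc
  exact ⟨C₀, hC₀, fun hz => stub_gram one_ne_zero (himp hz) h⟩

/-- The mirror in `_false_of_` form for the disprover. -/
theorem DilatedChowla_false_of_siegelZerosAbove
    (hz : ∀ C₀ : ℝ, 0 < C₀ → SiegelZerosAbove (fun q => C₀ * Real.log q)) : ¬ DilatedChowla :=
  fun h => by
    obtain ⟨C₀, hC₀, hno⟩ := siegelMirror h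
    exact hno (hz C₀ hC₀)

/-- The mirror read back on the tree's predicate: under the crux every Siegel zero at a large
conductor has quality `< C₀ log q` (a real-zero-free interval `[1 − 1/(C₀ log² q), 1)`). -/
theorem siegelMirror_quality (h : DilatedChowla) :
    ∃ C₀ : ℝ, 0 < C₀ ∧ ∃ q₀ : ℕ, ∀ (q : ℕ) [NeZero q] (χ : DirichletCharacter ℂ q) (η : ℝ),
      q₀ ≤ q → Literature.Barriers.Parity.IsSiegelZero χ η → η < C₀ * Real.log q := by
  obtain ⟨C₀, hC₀, hno⟩ := siegelMirror h
  refine ⟨C₀, hC₀, ?_⟩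
  by_contra hcon
  push Not at hcon
  apply hno
  intro q₀
  obtain ⟨q, hq, χ, η, hq₀, hz, hη⟩ := hcon q₀
  exact ⟨q, hq, χ, η, hq₀, hη, hz⟩

end Summit.Parity.GeneralizedHardyLittlewood.Cruxes.DilatedChowla.SiegelMirror

end
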